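import Summits.Ventures.QEC.Census.BB.BB288Rank
import Summits.Ventures.QEC.Theses.BB288DistanceCertificate
import HarnessLib

/-!
# Route BB288DistanceCertificate, item `TwelveLogicalQubits288` (stmt-Ventures-19835): `BB.bb288.k = 12`

Closer of the support item `TwelveLogicalQubits288 : (BB.bb288).k = 12` of route
`Summits/Ventures/QEC/Theses/BB288DistanceCertificate.lean` (LADDER-QEC rung Q2, the `[[288,12,18]]` bivariate-bicycle code
`QC(x³+y²+y⁷, y³+x+x²)` on `ℤ₁₂ × ℤ₁₂` of Bravyi–Cross–Gambetta–Maslov–Rall–Yoder 2024): the dimension of the typed code is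
`k = n − rank H^X − rank H^Z = 288 − 138 − 138 = 12`, both ranks established by kernel-checked RANK CERTIFICATES
(`Summits/Ventures/QEC/Census/BB/BB288Rank.lean`, p474628, qec-type-02, with its data/half files: CERT-FORMAT v1 §3 `k_cert`,
checker `RankCert.check` by `decide +kernel`, soundness `rank_rowMatrix_of_check`). This file only re-states `Census.bb288_k`
at the route declaration's type; it is the one file of the item allowed to import the Theses module (cell build rule).
Tier KERNEL: axioms ⊆ {propext, Classical.choice, Quot.sound}.
-/

namespace Summit.Ventures.QEC.Theorems

/-- **`k(BB288) = 12`** — route item `TwelveLogicalQubits288` (stmt-Ventures-19835) of route BB288DistanceCertificate,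
discharged by the kernel-checked rank certificates of `Census/BB/BB288Rank.lean` (`Census.bb288_k`:
`rank₂ H^X = rank₂ H^Z = 138`, `k = 288 − 138 − 138`).
[cite: BravyiEtAl2024, Nature 627 (2024) Table 1 row [[288,12,18]] and §4 Lemma 1 (arXiv:2308.07915: k = n − rk H^X − rk H^Z)] -/
theorem TwelveLogicalQubits288_proof :
    Summit.Ventures.QEC.Theses.BB288DistanceCertificate.TwelveLogicalQubits288 := by
  unfold Summit.Ventures.QEC.Theses.BB288DistanceCertificate.TwelveLogicalQubits288
  exact Summit.Ventures.QEC.Census.bb288_k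

end Summit.Ventures.QEC.Theorems
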